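import Literature.NumberTheory.Automorphic.GLnLeviQuotientIwasawaConstant
import Literature.NumberTheory.Automorphic.GLnLeviQuotientIwasawaCanonical
import HarnessLib

/-!
# Parabolic descent on `GL_n(F)` with canonical quotient measures, II: the constant is the Iwasawa constant of `ν ∕ ν_M`,
# and it is `1` at the volume-one normalisations
(Rogawski (1990), §4.13 Lemma 4.13.1 (a) p. 64 and its proof pp. 64–66; §4.3 (4.3.1) p. 43 «compatible measures»; §4.4 p. 44
normalisations `vol(K) = vol(K_M) = vol(U(𝒪)) = 1`; Deitmar–Echterhoff (2014), Thm. 1.5.3; Folland (1995), Thm. 2.49)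

Topic `NumberTheory/Automorphic`; namespace `Literature.NumberTheory.Automorphic`. KERNEL mathematics only: theorems, no definition, no
named fact, no instance, no `sorry`. Cell `pub/hodgecm-mathlib`, programme P3a, roads «D-N6s» ∕ «D-N7s», brick «D-S1c-one» part (II) (LEAD
F0P3a-plan T7-7 (B)(d3), T7-8, T7-17 (B)). The companion ★
`GLnLeviOrbitalDescentCanonical.exists_lintegral_descConj_quotientMeasure_eq_mul_lintegral_levi` («D-S1c-canonical») proves parabolic
descent `∫_{G⧸T} F(y p y⁻¹) d(ν∕t) = C ‖det(1 − K_p)‖⁻¹ ‖det K_p‖ ∫_{M⧸T} F^{(P)}(m p m⁻¹) d(ν_M∕t′)` for every closed torus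
`T ≤ M = M_c` with ONE constant `∃ C ∈ (0, ∞)`. By ★ `eq_unfoldingConstant_smul_quotientMeasure` that constant is, for every choice of
its idle binder `μ_{G∕M}`, the Iwasawa constant `C` of the CANONICAL quotient measure, `ν∕ν_M = C • π_*(κ ⊗ μ_U)`; part (I) ★
`GLnLeviQuotientIwasawaConstant` pins `C = 1` at the volume-one normalisations (`eq_one_of_quotientMeasure_eq_smul_map`), and ★
`GLnLeviQuotientIwasawaCanonical.quotientMeasure_levi_eq_map` (F0P3a-p04) is the hypothesis-free `ν∕ν_M = π_*(κ ⊗ μ_U)` there. This file: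

* §1 (two blocks, the frame of ★ «D-S1c-canonical» verbatim, its idle binder `μ_{G∕M}` removed, the torus data as plain binders)
  **`lintegral_descConj_quotientMeasure_eq_mul_lintegral_levi_of_eq_smul_map`** — parabolic descent for EVERY closed `T ≤ M` with the
  constant EXPLICIT: under `hq : ν∕ν_M = C • π_*(κ ⊗ μ_U)` the identity holds with constant exactly `C` (the proof of ★ D-S1c-canonical
  run through `μ_{G∕M} := ν∕ν_M`, whose three unfolding constants are `1`, ★ `unfoldingConstant_quotientMeasure`).
* §2 **`lintegral_descConj_quotientMeasure_eq_lintegral_levi_of_measure_eq_one`** — at `ν(K) = ν_M(M ∩ K) = κ(K) = μ_U(U_c ∩ K) = 1`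
  the constant is **`1`**: `∫⁻_{G⧸T} F(y p y⁻¹) d(ν∕t) = ‖det(1 − K_p)‖⁻¹ ‖det K_p‖ ∫⁻_{M⧸T} (∫⁻_{K×U_c} F(k ((m p m⁻¹) u) k⁻¹)) d(ν_M∕t′)`
  — the form the unit fundamental lemma at a split place (letter N7, «D-N7s» g1: Rogawski Prop. 4.9.1 (b) with `c = 1` for the units of
  the Hecke algebras) and the local transfer at a split place (letter N6) consume, with no constant left to track.

## References
* [Rogawski1990] J. D. Rogawski, *Automorphic Representations of Unitary Groups in Three Variables*, Ann. of Math. Stud. 123 (1990),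
  §4.13 Lemma 4.13.1 (a) p. 64, proof pp. 64–66; §4.3 (4.3.1) p. 43; §4.4 p. 44; §4.9 Prop. 4.9.1 (b) p. 55.
* [DeitmarEchterhoff2014] A. Deitmar, S. Echterhoff, *Principles of Harmonic Analysis*, 2nd ed. (2014), Thm. 1.5.3.
* [Folland1995] G. B. Folland, *A Course in Abstract Harmonic Analysis* (1995), §2.6 Thm. 2.49.
-/

set_option autoImplicit false

noncomputable section

open scoped MatrixGroups NNReal ENNReal
open MeasureTheory Measure Matrix Topology Set

namespace Literature.NumberTheory.Automorphic

open Literature.MeasureTheory.Group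
open Literature.NumberTheory.GaloisRepresentations.IsNonarchimedeanLocalField

/-! ## §1 Parabolic descent for every torus `T ≤ M`, the Iwasawa constant EXPLICIT (two blocks) -/

section Descent

variable (F : Type*) [Field F] [ValuativeRel F] [TopologicalSpace F] [IsNonarchimedeanLocalField F]
  [MeasurableSpace F] [BorelSpace F]
  {n : ℕ} {c : Fin n → Bool} [MeasurableSpace (GL (Fin n) F)] [BorelSpace (GL (Fin n) F)]

/-- **Parabolic descent with canonical quotient measures and EXPLICIT constant** (Rogawski 1990, Lemma 4.13.1 (a) and its proof,
«compatible measures» §4.3 p. 43). Two-block labelling `c`, `M = M_c`, Haar measures `ν`, `ν_M` on `GL_n(F)` and `M`, `κ`, `μ_U` on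
`K = GL_n(𝒪)` and `U_c`; suppose the canonical quotient measure is `ν∕ν_M = C • π_*(κ ⊗ μ_U)` in Iwasawa coordinates (★
`exists_quotientMeasure_levi_eq_smul_map_bool`; `C = 1` at the volume-one normalisations, `eq_one_of_quotientMeasure_eq_smul_map`).
Then for EVERY closed `T ≤ M`, every Haar inversion-invariant `t` on `T` (`t′` its transport to `T ⊓ M ≤ M`), every `p ∈ P_c ∩ M`
centralised by `T` with `det(1 − K_p) ≠ 0` and every Borel `F ≥ 0`:
`∫⁻_{G⧸T} F(y p y⁻¹) d(ν∕t) = C ‖det(1 − K_p)‖⁻¹ ‖det K_p‖ ∫⁻_{M⧸T} (∫⁻_{K×U_c} F(k ((m p m⁻¹) u) k⁻¹) d(κ ⊗ μ_U)) d(ν_M∕t′)` — the SAME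
`C`. This is ★ `exists_lintegral_descConj_quotientMeasure_eq_mul_lintegral_levi` («D-S1c-canonical») with its constant identified: the
proof is that one's (explicit chain rule ★ `lintegral_eq_unfoldingConstant_mul_lintegral_innerLIntegral` through `μ_{G∕M} := ν∕ν_M`, all
three unfolding constants `= 1` by ★ `unfoldingConstant_quotientMeasure`; Tonelli; the substitutions ★ `lintegral_prod_unipotent_conj_eq_mul`,
★ `lintegral_prod_unipotent_mul_parabolic_eq_mul` at `m p m⁻¹`) — adapted from ★ `GLnLeviOrbitalDescentCanonical`.
[cite: Rogawski1990, §4.13 Lemma 4.13.1 (a) pp. 64–66; §4.3 (4.3.1) p. 43] [cite: DeitmarEchterhoff2014, Thm. 1.5.3]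
[cite: Folland1995, §2.6 Thm. 2.49] -/
theorem lintegral_descConj_quotientMeasure_eq_mul_lintegral_levi_of_eq_smul_map
    [T2Space (GL (Fin n) F)] [SecondCountableTopology (GL (Fin n) F)] [LocallyCompactSpace (GL (Fin n) F)]
    {M : Subgroup (GL (Fin n) F)} (hM : M = standardLeviGL F c) (hMc : IsClosed (M : Set (GL (Fin n) F)))
    [LocallyCompactSpace ↥M] [MeasurableSpace (GL (Fin n) F ⧸ M)] [BorelSpace (GL (Fin n) F ⧸ M)]
    (ν : Measure (GL (Fin n) F)) [IsHaarMeasure ν] [ν.IsMulRightInvariant]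
    (νM : Measure ↥M) [IsHaarMeasure νM] [νM.IsMulRightInvariant] [νM.IsInvInvariant]
    (κ : Measure ↥(glInt n F)) [IsHaarMeasure κ]
    (μN : Measure ↥(unipotentRadicalGL F c)) [IsHaarMeasure μN] {C : ℝ≥0}
    (hq : quotientMeasure M νM hMc ν = C • Measure.map
      (fun q : ↥(glInt n F) × ↥(unipotentRadicalGL F c) =>
        (QuotientGroup.mk ((q.1 : GL (Fin n) F) * (q.2 : GL (Fin n) F)) : GL (Fin n) F ⧸ M)) (κ.prod μN))
    (T : Subgroup (GL (Fin n) F)) (hT : IsClosed (T : Set (GL (Fin n) F))) (hTM : T ≤ M)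
    [MeasurableSpace (GL (Fin n) F ⧸ T)] [BorelSpace (GL (Fin n) F ⧸ T)]
    [MeasurableSpace (↥M ⧸ T.subgroupOf M)] [BorelSpace (↥M ⧸ T.subgroupOf M)]
    (t : Measure ↥T) [IsHaarMeasure t] [t.IsInvInvariant]
    (t' : Measure ↥(T.subgroupOf M)) [IsHaarMeasure t'] [t'.IsInvInvariant]
    (ht' : t' = Measure.map (Subgroup.subgroupOfEquivOfLe hTM).symm t)
    (p : standardParabolicGL F c) (hpM : (p : GL (Fin n) F) ∈ M)
    (hpT : ∀ s ∈ T, s * (p : GL (Fin n) F) = (p : GL (Fin n) F) * s)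
    (hp : (1 - Matrix.of fun q q' : {i : Fin n // c i = false} × {j : Fin n // c j = true} =>
        ((p : GL (Fin n) F) : Matrix (Fin n) (Fin n) F) q.1 q'.1 *
          (((p⁻¹ : standardParabolicGL F c) : GL (Fin n) F) : Matrix (Fin n) (Fin n) F) q'.2 q.2).det
        ≠ 0)
    {Fn : GL (Fin n) F → ℝ≥0∞} (hFn : Measurable Fn) :
        ∫⁻ y, descConj (p : GL (Fin n) F) T hpT Fn y
            ∂(quotientMeasure T t hT ν) =
          C * ((normAbs F ((1 - Matrix.of
              fun q q' : {i : Fin n // c i = false} × {j : Fin n // c j = true} =>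
                ((p : GL (Fin n) F) : Matrix (Fin n) (Fin n) F) q.1 q'.1 *
                  (((p⁻¹ : standardParabolicGL F c) : GL (Fin n) F) : Matrix (Fin n) (Fin n) F)
                    q'.2 q.2).det)⁻¹ *
            normAbs F (Matrix.of
              fun q q' : {i : Fin n // c i = false} × {j : Fin n // c j = true} =>
                ((p : GL (Fin n) F) : Matrix (Fin n) (Fin n) F) q.1 q'.1 *
                  (((p⁻¹ : standardParabolicGL F c) : GL (Fin n) F) : Matrix (Fin n) (Fin n) F)
                    q'.2 q.2).det : ℝ≥0) : ℝ≥0∞) *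
          ∫⁻ z, descConj (⟨(p : GL (Fin n) F), hpM⟩ : ↥M) (T.subgroupOf M)
              (fun s hs => Subtype.ext (hpT (s : GL (Fin n) F) hs))
              (fun m : ↥M => ∫⁻ q : ↥(glInt n F) × ↥(unipotentRadicalGL F c),
                Fn ((q.1 : GL (Fin n) F) * ((m : GL (Fin n) F) * (q.2 : GL (Fin n) F)) *
                  (q.1 : GL (Fin n) F)⁻¹) ∂(κ.prod μN))
              z ∂(quotientMeasure (T.subgroupOf M) t' (isClosed_subgroupOf T M hT) νM) := by
  subst hM
  haveI : T2Space F := (isLocalField F).toT2Space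
  haveI : SecondCountableTopology F := secondCountableTopology_localField F
  haveI : LocallyCompactSpace F := (isLocalField F).toLocallyCompactSpace
  haveI : IsClosed ((standardLeviGL F c : Subgroup (GL (Fin n) F)) : Set (GL (Fin n) F)) := hMc
  haveI : BorelSpace ↥(unipotentRadicalGL F c) := Subtype.borelSpace _
  haveI : BorelSpace ↥(glInt n F) := Subtype.borelSpace _
  haveI : CompactSpace ↥(glInt n F) := isCompact_iff_compactSpace.1 (isCompact_glInt n F)
  haveI : IsFiniteMeasure κ := CompactSpace.isFiniteMeasure
  -- `U_c` is second countable locally compact (a box), so `μ_U` is s-finite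
  haveI : SecondCountableTopology ↥(unipotentRadicalGL F c) :=
    TopologicalSpace.Subtype.secondCountableTopology _
  haveI : LocallyCompactSpace ↥(unipotentRadicalGL F c) := by
    obtain ⟨Φ, -, -⟩ := exists_boxHomeomorph_unipotentRadicalGL (R := F) c
    exact Φ.symm.isClosedEmbedding.locallyCompactSpace
  haveI : SFinite μN := inferInstance
  haveI : SecondCountableTopology ↥(standardLeviGL F c) :=
    TopologicalSpace.Subtype.secondCountableTopology _
  haveI : SecondCountableTopology ↥(glInt n F) := TopologicalSpace.Subtype.secondCountableTopology _
  haveI : BorelSpace (↥(glInt n F) × ↥(unipotentRadicalGL F c)) := Prod.borelSpace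
  -- `μ_{G∕M} := ν∕ν_M`, the canonical quotient measure (invariant, Radon, non-zero)
  haveI : SFinite νM := inferInstance
  have hGM : quotientMeasure (standardLeviGL F c) νM hMc ν ≠ 0 := quotientMeasure_ne_zero _ _ _ _
  haveI : IsClosed (T : Set (GL (Fin n) F)) := hT
  haveI : SecondCountableTopology ↥T := TopologicalSpace.Subtype.secondCountableTopology _
  haveI : LocallyCompactSpace ↥T := hT.isClosedEmbedding_subtypeVal.locallyCompactSpace
  haveI : SFinite t := inferInstance
  haveI : IsClosed ((T.subgroupOf (standardLeviGL F c) : Subgroup ↥(standardLeviGL F c)) : Set ↥(standardLeviGL F c)) :=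
    isClosed_subgroupOf T (standardLeviGL F c) hT
  haveI : SecondCountableTopology ↥(T.subgroupOf (standardLeviGL F c)) :=
    TopologicalSpace.Subtype.secondCountableTopology _
  haveI : LocallyCompactSpace ↥(T.subgroupOf (standardLeviGL F c)) :=
    (isClosed_subgroupOf T (standardLeviGL F c) hT).isClosedEmbedding_subtypeVal.locallyCompactSpace
  haveI : SFinite t' := inferInstance
  haveI : SecondCountableTopology (↥(standardLeviGL F c) ⧸ T.subgroupOf (standardLeviGL F c)) := inferInstance
  haveI : BorelSpace ((↥(glInt n F) × ↥(unipotentRadicalGL F c)) ×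
      (↥(standardLeviGL F c) ⧸ T.subgroupOf (standardLeviGL F c))) := Prod.borelSpace
  haveI : SFinite (quotientMeasure (T.subgroupOf (standardLeviGL F c)) t'
    (isClosed_subgroupOf T (standardLeviGL F c) hT) νM) := inferInstance
  have hMT : quotientMeasure (T.subgroupOf (standardLeviGL F c)) t' (isClosed_subgroupOf T (standardLeviGL F c) hT) νM ≠ 0 :=
    quotientMeasure_ne_zero _ _ _ _
  -- (1) the chain rule with explicit constant: `u₁ = u₃ = 1`
  have hπ : Measurable fun q : ↥(glInt n F) × ↥(unipotentRadicalGL F c) =>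
      (QuotientGroup.mk ((q.1 : GL (Fin n) F) * (q.2 : GL (Fin n) F)) :
        GL (Fin n) F ⧸ standardLeviGL F c) :=
    ((QuotientGroup.continuous_mk (N := standardLeviGL F c)).comp
      ((continuous_subtype_val.comp continuous_fst).mul
        (continuous_subtype_val.comp continuous_snd))).measurable
  have hf : Measurable (descConj (p : GL (Fin n) F) T hpT Fn) := measurable_descConj _ _ _ hFn
  have hchain := lintegral_eq_unfoldingConstant_mul_lintegral_innerLIntegral T (standardLeviGL F c)
    (quotientMeasure T t hT ν) (quotientMeasure (standardLeviGL F c) νM hMc ν)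
    (quotientMeasure (T.subgroupOf (standardLeviGL F c)) t' (isClosed_subgroupOf T (standardLeviGL F c) hT) νM)
    ν νM t t' hTM ht' hGM hMT hf
  rw [unfoldingConstant_quotientMeasure T t ν, unfoldingConstant_quotientMeasure (standardLeviGL F c) νM ν,
    unfoldingConstant_quotientMeasure (T.subgroupOf (standardLeviGL F c)) t' νM] at hchain
  have hint : ∫⁻ y, innerLIntegral T (standardLeviGL F c)
        (quotientMeasure (T.subgroupOf (standardLeviGL F c)) t' (isClosed_subgroupOf T (standardLeviGL F c) hT) νM)
        (descConj (p : GL (Fin n) F) T hpT Fn) y ∂quotientMeasure (standardLeviGL F c) νM hMc ν =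
      ∫⁻ y, innerLIntegral T (standardLeviGL F c)
        (quotientMeasure (T.subgroupOf (standardLeviGL F c)) t' (isClosed_subgroupOf T (standardLeviGL F c) hT) νM)
        (descConj (p : GL (Fin n) F) T hpT Fn) y ∂(C • Measure.map
          (fun q : ↥(glInt n F) × ↥(unipotentRadicalGL F c) =>
            (QuotientGroup.mk ((q.1 : GL (Fin n) F) * (q.2 : GL (Fin n) F)) : GL (Fin n) F ⧸ standardLeviGL F c))
          (κ.prod μN)) := by
    rw [← hq]
  rw [hchain]
  simp only [ENNReal.coe_one, inv_one, one_mul]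
  rw [hint, lintegral_smul_measure,
    lintegral_map (measurable_innerLIntegral T (standardLeviGL F c)
      (quotientMeasure (T.subgroupOf (standardLeviGL F c)) t' (isClosed_subgroupOf T (standardLeviGL F c) hT) νM)
      (isClosed_standardLeviGL (R := F) c) hf) hπ]
  have hmk : ∀ q : ↥(glInt n F) × ↥(unipotentRadicalGL F c),
      innerLIntegral T (standardLeviGL F c)
        (quotientMeasure (T.subgroupOf (standardLeviGL F c)) t' (isClosed_subgroupOf T (standardLeviGL F c) hT) νM)
        (descConj (p : GL (Fin n) F) T hpT Fn)
        (QuotientGroup.mk ((q.1 : GL (Fin n) F) * (q.2 : GL (Fin n) F))) =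
      ∫⁻ z, descConj (p : GL (Fin n) F) T hpT Fn
        (((q.1 : GL (Fin n) F) * (q.2 : GL (Fin n) F)) • inclQuot T (standardLeviGL F c) z)
          ∂(quotientMeasure (T.subgroupOf (standardLeviGL F c)) t' (isClosed_subgroupOf T (standardLeviGL F c) hT) νM) :=
    fun q => innerLIntegral_mk _ _ _ _ _
  rw [lintegral_congr hmk]
  -- (2) Tonelli: swap `K × U_c` and `M ⧸ T`
  have hjoint : Measurable fun r : (↥(glInt n F) × ↥(unipotentRadicalGL F c)) ×
      (↥(standardLeviGL F c) ⧸ T.subgroupOf (standardLeviGL F c)) =>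
      descConj (p : GL (Fin n) F) T hpT Fn
        (((r.1.1 : GL (Fin n) F) * (r.1.2 : GL (Fin n) F)) • inclQuot T (standardLeviGL F c) r.2) :=
    hf.comp ((((continuous_subtype_val.comp continuous_fst).mul
      (continuous_subtype_val.comp continuous_snd)).comp continuous_fst).smul
      ((continuous_inclQuot T (standardLeviGL F c)).comp continuous_snd)).measurable
  rw [lintegral_lintegral_swap hjoint.aemeasurable]
  -- (3) the inner `K × U_c` integral at `z = mT`: the two substitutions at `m p m⁻¹`
  have hinner : ∀ z : ↥(standardLeviGL F c) ⧸ T.subgroupOf (standardLeviGL F c),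
      ∫⁻ q : ↥(glInt n F) × ↥(unipotentRadicalGL F c), descConj (p : GL (Fin n) F) T hpT Fn
          (((q.1 : GL (Fin n) F) * (q.2 : GL (Fin n) F)) • inclQuot T (standardLeviGL F c) z)
            ∂(κ.prod μN) =
        ((normAbs F ((1 - Matrix.of
              fun q q' : {i : Fin n // c i = false} × {j : Fin n // c j = true} =>
                ((p : GL (Fin n) F) : Matrix (Fin n) (Fin n) F) q.1 q'.1 *
                  (((p⁻¹ : standardParabolicGL F c) : GL (Fin n) F) : Matrix (Fin n) (Fin n) F)
                    q'.2 q.2).det)⁻¹ *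
            normAbs F (Matrix.of
              fun q q' : {i : Fin n // c i = false} × {j : Fin n // c j = true} =>
                ((p : GL (Fin n) F) : Matrix (Fin n) (Fin n) F) q.1 q'.1 *
                  (((p⁻¹ : standardParabolicGL F c) : GL (Fin n) F) : Matrix (Fin n) (Fin n) F)
                    q'.2 q.2).det : ℝ≥0) : ℝ≥0∞) *
          descConj (⟨(p : GL (Fin n) F), hpM⟩ : ↥(standardLeviGL F c))
            (T.subgroupOf (standardLeviGL F c)) (fun s hs => Subtype.ext (hpT (s : GL (Fin n) F) hs))
            (fun m : ↥(standardLeviGL F c) => ∫⁻ q : ↥(glInt n F) × ↥(unipotentRadicalGL F c),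
              Fn ((q.1 : GL (Fin n) F) * ((m : GL (Fin n) F) * (q.2 : GL (Fin n) F)) *
                (q.1 : GL (Fin n) F)⁻¹) ∂(κ.prod μN)) z := by
    intro z
    induction z using QuotientGroup.induction_on with
    | H m =>
      obtain ⟨mP, hmP⟩ : ∃ mP : standardParabolicGL F c, (mP : GL (Fin n) F) = (m : GL (Fin n) F) :=
        ⟨⟨(m : GL (Fin n) F), standardLeviGL_le F c m.2⟩, rfl⟩
      have hconj_coe : ((mP * p * mP⁻¹ : standardParabolicGL F c) : GL (Fin n) F) =
          (m : GL (Fin n) F) * (p : GL (Fin n) F) * (m : GL (Fin n) F)⁻¹ := by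
        rw [Subgroup.coe_mul, Subgroup.coe_mul, Subgroup.coe_inv, hmP]
      have hcoeM : ((m * ⟨(p : GL (Fin n) F), hpM⟩ * m⁻¹ : ↥(standardLeviGL F c)) : GL (Fin n) F) =
          (m : GL (Fin n) F) * (p : GL (Fin n) F) * (m : GL (Fin n) F)⁻¹ := by
        rw [Subgroup.coe_mul, Subgroup.coe_mul, Subgroup.coe_inv]
      have hpt : ∀ q : ↥(glInt n F) × ↥(unipotentRadicalGL F c),
          descConj (p : GL (Fin n) F) T hpT Fn
            (((q.1 : GL (Fin n) F) * (q.2 : GL (Fin n) F)) •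
              inclQuot T (standardLeviGL F c) (QuotientGroup.mk m)) =
          Fn ((q.1 : GL (Fin n) F) * (q.2 : GL (Fin n) F) * ((mP * p * mP⁻¹ : standardParabolicGL F c) :
              GL (Fin n) F) * ((q.1 : GL (Fin n) F) * (q.2 : GL (Fin n) F))⁻¹) := by
        intro q
        rw [inclQuot_mk, MulAction.Quotient.smul_mk, smul_eq_mul, descConj_mk, hconj_coe]
        congr 1
        simp only [_root_.mul_inv_rev]
        group
      rw [lintegral_congr hpt, lintegral_prod_unipotent_conj_eq_mul κ
          (fun k : ↥(glInt n F) => (k : GL (Fin n) F)) μN (mP * p * mP⁻¹)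
          (by rw [det_one_sub_boxAd_conj_eq]; exact hp),
        lintegral_prod_unipotent_mul_parabolic_eq_mul κ (fun k : ↥(glInt n F) => (k : GL (Fin n) F)) μN
          (mP * p * mP⁻¹),
        det_one_sub_boxAd_conj_eq, det_boxAd_conj_eq, descConj_mk, ← mul_assoc, ENNReal.coe_mul]
      simp only [hconj_coe, hcoeM]
  rw [lintegral_congr hinner, lintegral_const_mul' _ _ ENNReal.coe_ne_top, ENNReal.smul_def,
    smul_eq_mul, ← mul_assoc]

/-! ## §2 The constant is `1` at the volume-one normalisations -/

/-- **Parabolic descent with constant ONE** (Rogawski 1990, Lemma 4.13.1 (a) with the normalisations of §4.4: `vol(K) = 1` for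
`K = GL_n(𝒪)`, `K ∩ M`, `U_c(𝒪)`, and the compatible quotient measures `dg∕dt`, `dm∕dt`): if `ν(K) = 1`, `ν_M(M ∩ K) = 1`, `κ(K) = 1`,
`μ_U(U_c ∩ K) = 1`, then for every closed `T ≤ M`, `t`, `t′`, `p`, `F` as in §1,
`∫⁻_{G⧸T} F(y p y⁻¹) d(ν∕t) = ‖det(1 − K_p)‖⁻¹ ‖det K_p‖ ∫⁻_{M⧸T} (∫⁻_{K×U_c} F(k ((m p m⁻¹) u) k⁻¹) d(κ ⊗ μ_U)) d(ν_M∕t′)` — no constant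
(★ `quotientMeasure_levi_eq_map` and §1). At the unit of the Hecke algebra this is Rogawski's Prop. 4.9.1 (b) with
`c = 1` (letter N7 at a split place). [cite: Rogawski1990, §4.13 Lemma 4.13.1 (a) pp. 64–66; §4.4 p. 44; §4.9 Prop. 4.9.1 (b) p. 55]
[cite: DeitmarEchterhoff2014, Thm. 1.5.3] -/
theorem lintegral_descConj_quotientMeasure_eq_lintegral_levi_of_measure_eq_one
    [T2Space (GL (Fin n) F)] [SecondCountableTopology (GL (Fin n) F)] [LocallyCompactSpace (GL (Fin n) F)]
    (hc : Monotone c) {M : Subgroup (GL (Fin n) F)} (hM : M = standardLeviGL F c) (hMc : IsClosed (M : Set (GL (Fin n) F)))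
    [LocallyCompactSpace ↥M] [MeasurableSpace (GL (Fin n) F ⧸ M)] [BorelSpace (GL (Fin n) F ⧸ M)]
    (ν : Measure (GL (Fin n) F)) [IsHaarMeasure ν] [ν.IsMulRightInvariant]
    (νM : Measure ↥M) [IsHaarMeasure νM] [νM.IsMulRightInvariant] [νM.IsInvInvariant]
    (κ : Measure ↥(glInt n F)) [IsHaarMeasure κ]
    (μN : Measure ↥(unipotentRadicalGL F c)) [IsHaarMeasure μN]
    (hνK : ν (glInt n F : Set (GL (Fin n) F)) = 1) (hνMK : νM (Subtype.val ⁻¹' (glInt n F : Set (GL (Fin n) F))) = 1)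
    (hκ : κ Set.univ = 1) (hμN : μN (Subtype.val ⁻¹' (glInt n F : Set (GL (Fin n) F))) = 1)
    (T : Subgroup (GL (Fin n) F)) (hT : IsClosed (T : Set (GL (Fin n) F))) (hTM : T ≤ M)
    [MeasurableSpace (GL (Fin n) F ⧸ T)] [BorelSpace (GL (Fin n) F ⧸ T)]
    [MeasurableSpace (↥M ⧸ T.subgroupOf M)] [BorelSpace (↥M ⧸ T.subgroupOf M)]
    (t : Measure ↥T) [IsHaarMeasure t] [t.IsInvInvariant]
    (t' : Measure ↥(T.subgroupOf M)) [IsHaarMeasure t'] [t'.IsInvInvariant]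
    (ht' : t' = Measure.map (Subgroup.subgroupOfEquivOfLe hTM).symm t)
    (p : standardParabolicGL F c) (hpM : (p : GL (Fin n) F) ∈ M)
    (hpT : ∀ s ∈ T, s * (p : GL (Fin n) F) = (p : GL (Fin n) F) * s)
    (hp : (1 - Matrix.of fun q q' : {i : Fin n // c i = false} × {j : Fin n // c j = true} =>
        ((p : GL (Fin n) F) : Matrix (Fin n) (Fin n) F) q.1 q'.1 *
          (((p⁻¹ : standardParabolicGL F c) : GL (Fin n) F) : Matrix (Fin n) (Fin n) F) q'.2 q.2).det
        ≠ 0)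
    {Fn : GL (Fin n) F → ℝ≥0∞} (hFn : Measurable Fn) :
        ∫⁻ y, descConj (p : GL (Fin n) F) T hpT Fn y
            ∂(quotientMeasure T t hT ν) =
          ((normAbs F ((1 - Matrix.of
              fun q q' : {i : Fin n // c i = false} × {j : Fin n // c j = true} =>
                ((p : GL (Fin n) F) : Matrix (Fin n) (Fin n) F) q.1 q'.1 *
                  (((p⁻¹ : standardParabolicGL F c) : GL (Fin n) F) : Matrix (Fin n) (Fin n) F)
                    q'.2 q.2).det)⁻¹ *
            normAbs F (Matrix.of
              fun q q' : {i : Fin n // c i = false} × {j : Fin n // c j = true} =>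
                ((p : GL (Fin n) F) : Matrix (Fin n) (Fin n) F) q.1 q'.1 *
                  (((p⁻¹ : standardParabolicGL F c) : GL (Fin n) F) : Matrix (Fin n) (Fin n) F)
                    q'.2 q.2).det : ℝ≥0) : ℝ≥0∞) *
          ∫⁻ z, descConj (⟨(p : GL (Fin n) F), hpM⟩ : ↥M) (T.subgroupOf M)
              (fun s hs => Subtype.ext (hpT (s : GL (Fin n) F) hs))
              (fun m : ↥M => ∫⁻ q : ↥(glInt n F) × ↥(unipotentRadicalGL F c),
                Fn ((q.1 : GL (Fin n) F) * ((m : GL (Fin n) F) * (q.2 : GL (Fin n) F)) *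
                  (q.1 : GL (Fin n) F)⁻¹) ∂(κ.prod μN))
              z ∂(quotientMeasure (T.subgroupOf M) t' (isClosed_subgroupOf T M hT) νM) := by
  have hq := quotientMeasure_levi_eq_map F hc hM hMc ν hνK νM hνMK κ hκ μN hμN
  rw [← one_smul ℝ≥0 (Measure.map (fun q : ↥(glInt n F) × ↥(unipotentRadicalGL F c) =>
    (QuotientGroup.mk ((q.1 : GL (Fin n) F) * (q.2 : GL (Fin n) F)) : GL (Fin n) F ⧸ M)) (κ.prod μN))] at hq
  rw [lintegral_descConj_quotientMeasure_eq_mul_lintegral_levi_of_eq_smul_map F hM hMc ν νM κ μN hq T hT hTM t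
    t' ht' p hpM hpT hp hFn, ENNReal.coe_one, one_mul]

end Descent

end Literature.NumberTheory.Automorphic

end
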